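import Summits.BirchSwinnertonDyer.BirchSwinnertonDyer.Theses.PrintX10b
import Summits.BirchSwinnertonDyer.BirchSwinnertonDyer.Theorems.PrintX10bHowardContainmentAnyClassNumberX10bOfKolyvaginSystemBound
import HarnessLib

/-!
# Line `torsion-depth-x10b` on crux stmt-BirchSwinnertonDyer-23729 `HowardContainmentAnyClassNumberX10b` — skeleton v4
# (RESHAPE by the lead, x10b-p2 LEAD g12, 2026-08-29): the residual cut down to «the Heegner-point Kolyvagin system EXISTS
# on the even-`d_K`, `3 ∣ h_K` X10b frames» (CGS 2025 Thm. 6.5.1 typed record-free by lit g45, p699162; composition p700296)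

History. v2 (LEAD g11): leaves 23236 / 27112 / 25233 + `R_even` (the crux's own conclusion on even `d_K`, `3 ∣ h_K`). v3 (this
seat, p696955): 27112 / 25233 / Cornut–Vatsal + «Thm. 6.5.2 (i)–(ii) on the `R_even` frames». The desks (lit g45 DOSSIER §74,
ref g8 REF-157) ruled that Thm. 6.5.2 carries CGLS 2022's (disc) by citation-import, and lit typed Math. Ann. 393 Thm. 6.5.1 —
the ABSTRACT Kolyvagin-system bound, printed under the §6 standing only (no (Heeg), no (disc)) — RECORD-FREE
(`CastellaGrossiSkinner2025.thm651_rankOne_charIdeal_torsion_dvd_pLocalized_of_kolyvaginSystem` over `thm651Setting`,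
= `thm411Setting` by `rfl`). p700296 (`Theorems/PrintX10bHowardContainmentAnyClassNumberX10bOfKolyvaginSystemBound.lean`, this
seat) composes: 23729 BY NAME ⟸ Thm. 6.5.1 + F-411 (odd `d_K`) + MZ26 Cor. 4.6 (`3 ∤ h_K`) + «F-411's BODY over `thm651Setting` on
the `R_even` frames». So v4:

* `stub_thm651Leaf` := the Literature leaf `CastellaGrossiSkinner2025.thm651_rankOne_charIdeal_torsion_dvd_pLocalized_of_kolyvaginSystem`
  BY NAME (CGS 2025 Thm. 6.5.1; print, cite-only; record-free);
* `stub_kolyvaginSystemLeaf` := the route leaf `CGLSHeegnerKolyvaginSystem` BY NAME (CGLS 2022 Thm. 4.1.1 in KS form, 23236; print,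
  cite-only) — back from v2, used on the ODD-`d_K` frames only;
* `stub_mastellaZermanHowardDivisibility` := the route leaf `MastellaZermanHowardDivisibility` BY NAME (25233; print, cite-only);
* `stub_ks_evenDisc_divisibleClassNumber` := «the Heegner-point Kolyvagin system EXISTS on the `R_even` frames»: binders of the
  crux verbatim + `¬ Odd (NumberField.discr K)` + `p ∣ NumberField.classNumber K` + `(hE : E(K)[p] = 0)`, then for every `jbar D C z`
  (`proj_k z = δ(κ_k(C))` above the torsion depth) and every choice of presentation slots `π P hP hPlev cd πbar Dsrc`: a
  Kolyvagin system `κ` of `thm651Setting (N_E) W K p κ rfl jbar π P hP cd πbar Dsrc` with `κ.one ≠ 0` on the `Λ`-line of `Φ′(z)`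
  — F-411 (`thm411_exists_kolyvaginSystem_one_ne_zero`) with its (disc) field deleted, restricted to those frames. BEYOND TYPED
  PRINT: the construction is Howard 2004 §2.3 / CGLS 2022 Thm. 4.1.1's «almost verbatim» adaptation at `p ∣ h_K` (no parity is
  used), `κ₁ ≠ 0` is Cornut–Vatsal (parity-free); printed only under CGLS §4.1's standing (disc).

Composition `HowardContainmentAnyClassNumberX10b_of` := the landed CENSUS III
`PrintX10bOfKSBound.howardContainmentAnyClassNumberX10b_of_thm651_ksLeaf_mz_of_ksOnEvenFrames` (p700296) — sorry-free; the crux BY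
NAME. NOT route currency (PIN-1 / R0: the untied `∃ F` is μ-blind); the item stays OPEN·aside as filed. BSD is not proved by
any of this.
-/

set_option linter.dupNamespace false
set_option autoImplicit false

noncomputable section

open scoped Classical NumberField

namespace Summit.BirchSwinnertonDyer.BirchSwinnertonDyer.Cruxes.HowardContainmentAnyClassNumberX10b.TorsionDepthX10b

open IsDedekindDomain
open WeierstrassCurve Literature.NumberTheory.EllipticCurves Literature.NumberTheory.EllipticCurves.ModularForms
  Literature.NumberTheory.EllipticCurves.ZpExtension
  Literature.NumberTheory.GaloisCohomology.Howard2004 Literature.NumberTheory.GaloisRepresentations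
  Literature.NumberTheory.GaloisRepresentations.DiscreteGaloisModule
open Literature.NumberTheory.EllipticCurves.CastellaGrossiLeeSkinner2022
open Literature.NumberTheory.EllipticCurves.Rank1Residual (ClassX10 Surj)

/-! ## Stub statements (v4) -/

/-- **PRINT LEAF BY NAME (record-free)**: CGS 2025 Thm. 6.5.1, the abstract Kolyvagin-system bound — the Literature leaf
`CastellaGrossiSkinner2025.thm651_rankOne_charIdeal_torsion_dvd_pLocalized_of_kolyvaginSystem` (p699162), cite-only, never seat work.
[cite: CastellaGrossiSkinner2025, Thm. 6.5.1] -/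
def Stmt.stub_thm651Leaf : Prop :=
  Literature.NumberTheory.EllipticCurves.CastellaGrossiSkinner2025.thm651_rankOne_charIdeal_torsion_dvd_pLocalized_of_kolyvaginSystem

/-- **PRINT LEAF BY NAME (F-411)**: CGLS 2022 Thm. 4.1.1 in Kolyvagin-system form — the route item `CGLSHeegnerKolyvaginSystem`
(stmt-BirchSwinnertonDyer-23236), cite-only, never seat work; used on the odd-`d_K` frames. [cite: CastellaGrossiLeeSkinner2022, Thm. 4.1.1] -/
def Stmt.stub_kolyvaginSystemLeaf : Prop :=
  Summit.BirchSwinnertonDyer.BirchSwinnertonDyer.Theses.PrintX10b.CGLSHeegnerKolyvaginSystem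

/-- **PRINT LEAF BY NAME**: Mastella–Zerman 2026 Cor. 4.6 — the route item `MastellaZermanHowardDivisibility`
(stmt-BirchSwinnertonDyer-25233), cite-only, never seat work. [cite: MastellaZerman2026, Cor. 4.6] -/
def Stmt.stub_mastellaZermanHowardDivisibility : Prop :=
  Summit.BirchSwinnertonDyer.BirchSwinnertonDyer.Theses.PrintX10b.MastellaZermanHowardDivisibility

/-- **THE ONE RESIDUAL (v4): «the Heegner-point Kolyvagin system EXISTS on the X10b Heegner frames with `d_K` EVEN (`≠ -4`) and
`3 ∣ h_K`»** — binders of the crux verbatim + `¬ Odd (NumberField.discr K)` + `p ∣ NumberField.classNumber K` + (h1) as a binder,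
then CGLS 2022 Thm. 4.1.1's BODY (F-411: a Kolyvagin system of `(𝐓, 𝓕_Λ, 𝓛_E)` with `κ₁ ≠ 0` on the `Λ`-line of `Φ′(κ_∞(C))`, for
every `D C z` and every choice of presentation slots) over the record-free setting `CastellaGrossiSkinner2025.thm651Setting`.
= F-411 with its (disc) field deleted, on those frames; beyond typed print (the hypothesis text of p700296's CENSUS III verbatim).
[cite: CastellaGrossiLeeSkinner2022, Thm. 4.1.1 and Rem. 4.1.4; §4.1 standing (disc) (arXiv:2008.02571v2 TeX L2186, L248–249)]
[cite: Howard2004HeegnerKolyvagin, §2.3 and Thm. 2.3.1 (the construction)] -/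
def Stmt.stub_ks_evenDisc_divisibleClassNumber : Prop :=
    ∀ (W : WeierstrassCurve ℚ) [W.IsElliptic] [W.IsGloballyMinimal] (p : ℕ) [Fact p.Prime]
      [NeZero (W.conductorNorm ℤ)] (K : Type) [Field K] [NumberField K],
      ClassX10 W p → ¬ Surj W 3 → ¬ W.HasCM →
      IsImaginaryQuadratic K → NumberField.discr K ≠ -3 → NumberField.discr K ≠ -4 →
      SatisfiesHeegnerHypothesis (W.conductorNorm ℤ) K → SatisfiesHeegnerHypothesis p K →
      ∀ (κ : ZpExtension K p), κ.IsAnticyclotomic → ∀ (γ : Field.absoluteGaloisGroup K) (hγ : κ.IsTopGenerator γ),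
      ¬ Odd (NumberField.discr K) → p ∣ NumberField.classNumber K →
      ∀ (hE : ∀ Q : (W.baseChange K).toAffine.Point, p • Q = 0 → Q = 0)
        (jbar : AlgebraicClosure K →+* ℂ) (D : (W.baseChange K).LambdaAdicSelmerData κ γ)
        (C : StabilizedHeegnerData (W.conductorNorm ℤ) W K κ jbar)
        (z : D.S) (_hz : ∀ (k : ℕ) (hk : C.depth < k), D.proj k z ∈ stabilizedClassLayer C k hk)
        (π : ∀ v : HeightOneSpectrum (𝓞 K), TamePin v)
        (P : Finset (HeightOneSpectrum (𝓞 K)) → HeightOneSpectrum (𝓞 K) → Prop)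
        (hP : ∀ j n v, P n v → TameHyp (fun n ↦ W.shapiroLevelQuot (κ.unitTwist (-1)) j n) n v)
        (_hPlev : ∀ n ∈ levels (heegnerKolyvaginPrimes W (κ.unitTwist (-1))
            (placesDividing K (p * W.conductorNorm ℤ) mul_level_ne_zero)), ∀ v ∈ n, P n v)
        (cd : ConjugationDatum K),
        letI := W.shapiroResidueModule K p
        ∀ (πbar : ∀ j, W.ShapiroLevel K p j →ₗ[IwasawaAlgebra p ⧸ shapiroIdeal p (j + 1)] (W.baseChange K).geomTorsion (p : ℤ))
          (Dsrc : ∀ j, DualityDatum p cd ((W.shapiroTower K p (κ.unitTwist (-1))).ρ j)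
            (IwasawaAlgebra p ⧸ shapiroIdeal p (j + 1))),
        ∃ κKS : (CastellaGrossiSkinner2025.thm651Setting (W.conductorNorm ℤ) W K p κ rfl jbar π P hP cd πbar Dsrc).KolyvaginSystem,
          κKS.one ≠ 0 ∧
          (∃ a : IwasawaAlgebra p, κKS.one =
            (W.shapiroTower K p (κ.unitTwist (-1))).smulFamily a (W.toShapiroSuccLimitH1 D hγ hE z).1) ∧
          (∃ b : IwasawaAlgebra p, (W.toShapiroSuccLimitH1 D hγ hE z).1 =
            (W.shapiroTower K p (κ.unitTwist (-1))).smulFamily b κKS.one)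

/-! ## The stubs (the ONLY sorries of the file) -/

theorem stub_thm651Leaf : Stmt.stub_thm651Leaf := by
  sorry

theorem stub_kolyvaginSystemLeaf : Stmt.stub_kolyvaginSystemLeaf := by
  sorry

theorem stub_mastellaZermanHowardDivisibility : Stmt.stub_mastellaZermanHowardDivisibility := by
  sorry

theorem stub_ks_evenDisc_divisibleClassNumber : Stmt.stub_ks_evenDisc_divisibleClassNumber := by
  sorry

/-! ## Composition (kernel-checked, no `sorry`): the landed CENSUS III of p700296 -/

/-- **The four stubs give the crux BY NAME** — the landed census theorem
`PrintX10bOfKSBound.howardContainmentAnyClassNumberX10b_of_thm651_ksLeaf_mz_of_ksOnEvenFrames` (p700296): odd `d_K` ↦ F-411 +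
Thm. 6.5.1 through the parity-free core; even `d_K`, `3 ∤ h_K` ↦ MZ26 Cor. 4.6; even `d_K`, `3 ∣ h_K` ↦ the residual stub + Thm.
6.5.1 through the same core. [cite: CastellaGrossiSkinner2025, Thm. 6.5.1] [cite: CastellaGrossiLeeSkinner2022, Thm. 4.1.1]
[cite: MastellaZerman2026, Cor. 4.6] -/
theorem HowardContainmentAnyClassNumberX10b_of
    (h₁ : Stmt.stub_thm651Leaf) (h₂ : Stmt.stub_kolyvaginSystemLeaf)
    (h₃ : Stmt.stub_mastellaZermanHowardDivisibility) (h₄ : Stmt.stub_ks_evenDisc_divisibleClassNumber) :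
    Summit.BirchSwinnertonDyer.BirchSwinnertonDyer.Theses.PrintX10b.HowardContainmentAnyClassNumberX10b :=
  Summit.BirchSwinnertonDyer.BirchSwinnertonDyer.Theorems.PrintX10bOfKSBound.howardContainmentAnyClassNumberX10b_of_thm651_ksLeaf_mz_of_ksOnEvenFrames
    h₁ h₂ h₃ h₄

/-- The composed line from the four stubs (sorries only through `stub_*`). -/
theorem HowardContainmentAnyClassNumberX10b_of_stubs :
    Summit.BirchSwinnertonDyer.BirchSwinnertonDyer.Theses.PrintX10b.HowardContainmentAnyClassNumberX10b :=
  HowardContainmentAnyClassNumberX10b_of stub_thm651Leaf stub_kolyvaginSystemLeaf stub_mastellaZermanHowardDivisibility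
    stub_ks_evenDisc_divisibleClassNumber

end Summit.BirchSwinnertonDyer.BirchSwinnertonDyer.Cruxes.HowardContainmentAnyClassNumberX10b.TorsionDepthX10b

end
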